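import Summits.MatrixMultiplication.OmegaCensus.STPP222TetraSearch

/-!
# ω-census, the pattern `(2,2,2)⁴`: `(2,2,2)⁴` is infeasible in `(ℤ/2)⁵` — kernel search, part 2 of 3

HONEST FRAMING (pub-omega census; verbatim): lottery ticket; floor = certified bounds/negative ranges.
Census STRUCTURE bookkeeping (question Q7, row `k = 4`: a KERNEL second leg for the lower half `n₄ ≥ 56` on the one cell,
`(ℤ/2)⁵`, that no second census engine reaches), not progress on `ω`.

Chunks 3–5 of the kernel mask search (`STPP222TetraNeg.searchB4` on bit-vector codes with `xorArith`, `decide +kernel`, one chunk ≤ 0.73 M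
clause evaluations) below the single start `(a₀, b₀, c₀) = (e₅, e₄, e₃)` = codes `(1, 2, 4)` of `(ℤ/2)⁵`, split by the code of `q₁`; assembled
in `STPP222TetraNoneZ2pow5.lean`.  Measured ≈ 72 µs per clause evaluation on the farm.

References: H. Cohn, R. Kleinberg, B. Szegedy, C. Umans, FOCS 2005 (arXiv:math/0511460), Def. 5.1.
Record: pub-omega HOME `pub-omega-eng2-g23/tetra/` (ENG2 gen 23, 2026-08-26): generators `k4gen.py` (clause lists; levels 0–12 are
literally the `(2,2,2)³` words), `search4.py` (Python mirror of this engine, node-for-node equal to the C census engine cfind v1.2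
run WITHOUT symmetry flags on `(ℤ/2)⁵`: 48 024 nodes / 4 115 340 clause evaluations, INFEASIBLE), `gen5.py` (the `GL₅(𝔽₂)` cover maps).
-/

set_option Elab.async false  -- many kernel pieces: elaborate sequentially (memory)

namespace Summit.MatrixMultiplication.OmegaCensus

namespace STPP222TetraNeg

/-! ## Kernel search chunks 3–5 of the start `(1, 2, 4)` of `(ℤ/2)⁵` -/

/-- Start-list chunk 3: the start `(1, 2, 4)` with `q₁`-codes `11–13` (544760 clause evaluations in ENG2's Python mirror ≈ 39 s of kernel time). -/
def ch3 : List (ℕ × ℕ × ℕ × List ℕ) := [(1, 2, 4, [11, 12, 13])]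

/-- Start-list chunk 4: the start `(1, 2, 4)` with `q₁`-codes `14–16` (538792 clause evaluations in ENG2's Python mirror ≈ 39 s of kernel time). -/
def ch4 : List (ℕ × ℕ × ℕ × List ℕ) := [(1, 2, 4, [14, 15, 16])]

/-- Start-list chunk 5: the start `(1, 2, 4)` with `q₁`-codes `17–18` (525144 clause evaluations in ENG2's Python mirror ≈ 38 s of kernel time). -/
def ch5 : List (ℕ × ℕ × ℕ × List ℕ) := [(1, 2, 4, [17, 18])]

/-- Kernel search, chunk 3. -/
theorem Z2pow5.s3 : searchB4 xorArith (List.range 32) ch3 = true := by 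
  decide +kernel

/-- Kernel search, chunk 4. -/
theorem Z2pow5.s4 : searchB4 xorArith (List.range 32) ch4 = true := by 
  decide +kernel

/-- Kernel search, chunk 5. -/
theorem Z2pow5.s5 : searchB4 xorArith (List.range 32) ch5 = true := by 
  decide +kernel

end STPP222TetraNeg

end Summit.MatrixMultiplication.OmegaCensus
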